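import Summits.CriticalPhenomena.SAWScalingLimit.Theorems.SAWDefectDecoherencePolygonParitySqueezeDefs
import Summits.CriticalPhenomena.SAWScalingLimit.Theorems.SAWDefectDecoherenceBoundaryClosureRGateTraceGreen
import Summits.CriticalPhenomena.SAWScalingLimit.Theorems.SAWDefectDecoherenceBoundaryClosureRSqueezeGateStability
import Summits.CriticalPhenomena.SAWScalingLimit.Theorems.SAWDefectDecoherenceBoundaryClosureRGateProfileAnalysis
import HarnessLib

/-!
# Crux `BoundaryClosureR` (stmt-CriticalPhenomena-14004), line `polygon-parity-squeeze`,
# stub `gateProfile_of_identification` (piece F of the (A) assembly): the side measure on the gate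
# ball is a constant multiple of the candidate line density

THEOREM (`integral_eq_const_mul_lineIntegral`).  Let the carrier `Ω` of `D` be flat at `b = pt 1`
inside `B(b, ρ)`, let `gs` be holomorphic on `Ω ∩ B(b, ρ)` and continuous up to the gate
(`{im ≥ im b} ∩ B(b, ρ)`), `g = gs` on `Ω ∩ B(b, ρ)`, and let `μ` be a positive measure on `ℂ`,
finite on `B̄(b, ρ/2)`, such that
* (no mass off the line) `∫ w dμ = 0` for every real continuous compactly supported `w` supported in
  `B(b, ρ/2)` off the horizontal line through `b`;
* (local gate identity) every gate point `y` of `B(b, ρ)` has a ball `B(y, s)` with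
  `∫_Ω g ∂̄φ dA = θ ∫ φ dμ` for all `φ ∈ C_c^∞(B(y, s))` (`θ ≠ 0` a fixed constant; `θ = −√3 i` in
  the line).
Then for EVERY continuous compactly supported `φ` with `tsupport φ ⊆ B(b, ρ/2)`,
  `∫ φ dμ = (−(i/2)/θ) ∫_{(re b − ρ/2, re b + ρ/2)} φ(x + i im b) gs(x + i im b) dx`.
Proof: Green's formula on the gate half-ball (`GateTrace.gateTrace_green_halfPlane`) turns the local
gate identity into the local form of the display for smooth `φ` near gate points; off the line both
sides vanish locally; a smooth partition of unity (`GateProfile.apply_eq_zero_of_locally_zero`)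
globalises to `C_c^∞(B(b, ρ/2))`, and mollification (`exists_contDiff_dist_le_of_tsupport_subset`)
passes to continuous `φ`.

References: H. Duminil-Copin, S. Smirnov, Ann. of Math. 175 (2012), §3; L. Hörmander, *ALPDO I*,
Thm. 1.4.4, Thm. 1.3.2.
-/

noncomputable section

open scoped Topology ContDiff
open Filter Set Metric MeasureTheory Complex
open Literature.Probability.RandomPlanarGeometry
open Literature.Analysis.Complex (dbarAlong dbarAlong_eq_zero_of_notMem_tsupport)

namespace Summit.CriticalPhenomena.SAWScalingLimit.Theorems.PolygonParitySqueeze.GateProfile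

/-! ### 1. Test functions supported in a ball of finite mass -/

/-- A continuous compactly supported function vanishing off a ball of finite `μ`-mass is
`μ`-integrable. [folklore] -/
theorem integrable_of_eq_zero_off_ball {μ : Measure ℂ} {c : ℂ} {r : ℝ}
    (hfin : μ (closedBall c r) < ⊤) {φ : ℂ → ℂ} (hφ : Continuous φ) (hφc : HasCompactSupport φ)
    (hφs : ∀ z, z ∉ ball c r → φ z = 0) : Integrable φ μ := by
  obtain ⟨M, hM⟩ := hφc.exists_bound_of_continuous hφ
  have h1 : IntegrableOn φ (closedBall c r) μ :=
    Measure.integrableOn_of_bounded hfin.ne hφ.aestronglyMeasurable (Eventually.of_forall hM)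
  refine (integrableOn_iff_integrable_of_support_subset fun x hx => ?_).1 h1
  by_contra hxc
  exact hx (hφs x fun h => hxc (ball_subset_closedBall h))

/-- The integral of a function vanishing off a ball of finite `μ`-mass and bounded by `C` has norm
at most `C · μ(B̄)`. [folklore] -/
theorem norm_integral_le_of_eq_zero_off_ball {μ : Measure ℂ} {c : ℂ} {r : ℝ}
    (hfin : μ (closedBall c r) < ⊤) {φ : ℂ → ℂ} (hφs : ∀ z, z ∉ ball c r → φ z = 0) {C : ℝ}
    (hC : ∀ x, ‖φ x‖ ≤ C) : ‖∫ z, φ z ∂μ‖ ≤ C * μ.real (closedBall c r) := by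
  rw [← setIntegral_eq_integral_of_forall_compl_eq_zero (s := closedBall c r) fun x hx =>
    hφs x fun h => hx (ball_subset_closedBall h)]
  exact norm_setIntegral_le_of_norm_le_const hfin fun x _ => hC x

/-- A function supported in `B(p, R)` vanishes on the horizontal line through `p` outside the
window `|x − re p| < R`, so its line integral against any `u` is the window integral. [folklore] -/
theorem lineIntegral_eq_window (p : ℂ) {R : ℝ} {φ : ℂ → ℂ} (hφs : tsupport φ ⊆ ball p R)
    (u : ℂ → ℂ) :
    ∫ x : ℝ, φ ((x : ℂ) + (p.im : ℂ) * I) * u ((x : ℂ) + (p.im : ℂ) * I) =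
      ∫ x in Set.Ioo (p.re - R) (p.re + R),
        φ ((x : ℂ) + (p.im : ℂ) * I) * u ((x : ℂ) + (p.im : ℂ) * I) := by
  refine (setIntegral_eq_integral_of_forall_compl_eq_zero fun x hx => ?_).symm
  have hout : (x : ℂ) + (p.im : ℂ) * I ∉ tsupport φ := fun hmem => hx ?_
  · rw [image_eq_zero_of_notMem_tsupport hout, zero_mul]
  have hb := mem_ball.1 (hφs hmem)
  rw [dist_gatePoint, abs_lt] at hb
  exact ⟨by linarith, by linarith⟩

/-! ### 2. The carrier pairing as a half-plane pairing -/

/-- Under flatness at `pt 1` (radius `ρ`), for `φ` supported in `B(pt 1, ρ)` and `g = gs` on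
`Ω ∩ B(pt 1, ρ)`: `∫_Ω g ∂̄φ = ∫_{im > im pt 1} ∂̄φ · gs` (both integrands live on the upper
half-ball, where they agree). [folklore] -/
theorem setIntegral_carrier_eq_halfPlane (D : DobrushinDomain) {ρ : ℝ}
    (hflat : D.carrier ∩ ball (D.pt 1) ρ = {z : ℂ | (D.pt 1).im < z.im} ∩ ball (D.pt 1) ρ)
    {g gs : ℂ → ℂ} (hg : EqOn g gs (D.carrier ∩ ball (D.pt 1) ρ)) {φ : ℂ → ℂ}
    (hφs : tsupport φ ⊆ ball (D.pt 1) ρ) :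
    ∫ w in D.carrier, g w * dbarAlong 1 φ w =
      ∫ z in {z : ℂ | (D.pt 1).im < z.im}, dbarAlong 1 φ z * gs z := by
  have hzero : ∀ z, z ∉ ball (D.pt 1) ρ → dbarAlong 1 φ z = 0 := fun z hz =>
    dbarAlong_eq_zero_of_notMem_tsupport fun h => hz (hφs h)
  have hmeas : MeasurableSet {z : ℂ | (D.pt 1).im < z.im} :=
    measurableSet_lt measurable_const Complex.measurable_im
  have h1 : ∫ w in D.carrier, g w * dbarAlong 1 φ w =
      ∫ w in D.carrier ∩ ball (D.pt 1) ρ, g w * dbarAlong 1 φ w := by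
    refine setIntegral_eq_of_subset_of_forall_sdiff_eq_zero D.isOpen.measurableSet
      inter_subset_left ?_
    rintro z ⟨hzD, hz⟩
    rw [hzero z fun h => hz ⟨hzD, h⟩, mul_zero]
  have h2 : ∫ z in {z : ℂ | (D.pt 1).im < z.im}, dbarAlong 1 φ z * gs z =
      ∫ z in {z : ℂ | (D.pt 1).im < z.im} ∩ ball (D.pt 1) ρ, dbarAlong 1 φ z * gs z := by
    refine setIntegral_eq_of_subset_of_forall_sdiff_eq_zero hmeas inter_subset_left ?_
    rintro z ⟨hzU, hz⟩
    rw [hzero z fun h => hz ⟨hzU, h⟩, zero_mul]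
  rw [h1, h2, hflat]
  refine setIntegral_congr_fun (hmeas.inter isOpen_ball.measurableSet) fun z hz => ?_
  have hzD : z ∈ D.carrier ∩ ball (D.pt 1) ρ := by rw [hflat]; exact hz
  rw [hg hzD, mul_comm]

/-! ### 3. The identification -/

/-- **The side measure on the gate ball is `(−(i/2)/θ)` times the candidate line density**
(see the module docstring for the statement and the proof).
[cite: DuminilCopinSmirnov2012, §3 (the boundary part α of the strip)] -/
theorem integral_eq_const_mul_lineIntegral (D : DobrushinDomain) {ρ : ℝ} (hρ : 0 < ρ)
    (hflat : D.carrier ∩ ball (D.pt 1) ρ = {z : ℂ | (D.pt 1).im < z.im} ∩ ball (D.pt 1) ρ)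
    {g gs : ℂ → ℂ} (hg : EqOn g gs (D.carrier ∩ ball (D.pt 1) ρ))
    (hgsd : DifferentiableOn ℂ gs (D.carrier ∩ ball (D.pt 1) ρ))
    (hgsc : ContinuousOn gs ({z : ℂ | (D.pt 1).im ≤ z.im} ∩ ball (D.pt 1) ρ))
    {μ : Measure ℂ} (hfin : μ (closedBall (D.pt 1) (ρ / 2)) < ⊤)
    (hvan : ∀ w : ℂ → ℝ, Continuous w → HasCompactSupport w →
      tsupport w ⊆ ball (D.pt 1) (ρ / 2) → (∀ z ∈ tsupport w, z.im ≠ (D.pt 1).im) →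
        ∫ z, w z ∂μ = 0)
    {θ : ℂ} (hθ : θ ≠ 0)
    (hgate : ∀ y ∈ ball (D.pt 1) ρ, y.im = (D.pt 1).im → ∃ s : ℝ, 0 < s ∧ ∀ φ : ℂ → ℂ,
      ContDiff ℝ ∞ φ → HasCompactSupport φ → tsupport φ ⊆ ball y s →
        ∫ w in D.carrier, g w * dbarAlong 1 φ w = θ * ∫ w, φ w ∂μ)
    {φ : ℂ → ℂ} (hφ : Continuous φ) (hφc : HasCompactSupport φ)
    (hφs : tsupport φ ⊆ ball (D.pt 1) (ρ / 2)) :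
    ∫ z, φ z ∂μ = (-(I / 2) / θ) * ∫ x in Set.Ioo ((D.pt 1).re - ρ / 2) ((D.pt 1).re + ρ / 2),
      φ ((x : ℂ) + ((D.pt 1).im : ℂ) * I) * gs ((x : ℂ) + ((D.pt 1).im : ℂ) * I) := by
  set p : ℂ := D.pt 1 with hp
  set K : ℂ := -(I / 2) / θ with hK
  have hρ2 : ρ / 2 < ρ := by linarith
  ---------------------------------------------------------------- the line density
  have hγ : Continuous fun x : ℝ => (x : ℂ) + (p.im : ℂ) * I := by fun_prop
  have hgl : ContinuousOn (fun x : ℝ => gs ((x : ℂ) + (p.im : ℂ) * I))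
      (Icc (p.re - ρ / 2) (p.re + ρ / 2)) := by
    refine hgsc.comp hγ.continuousOn fun x hx => ⟨?_, ?_⟩
    · show p.im ≤ ((x : ℂ) + (p.im : ℂ) * I).im
      simp
    · rw [mem_ball, dist_gatePoint, abs_lt]
      constructor <;> linarith [hx.1, hx.2]
  have hGint : ∀ ψ : ℂ → ℂ, Continuous ψ →
      IntegrableOn (fun x : ℝ => ψ ((x : ℂ) + (p.im : ℂ) * I) * gs ((x : ℂ) + (p.im : ℂ) * I))
        (Ioo (p.re - ρ / 2) (p.re + ρ / 2)) := fun ψ hψ =>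
    integrableOn_gate (hψ.comp hγ) hgl
  have hoff : ∀ ψ : ℂ → ℂ, tsupport ψ ⊆ ball p (ρ / 2) → ∀ z, z ∉ ball p (ρ / 2) → ψ z = 0 :=
    fun ψ hψs z hz => image_eq_zero_of_notMem_tsupport fun h => hz (hψs h)
  ---------------------------------------------------------------- the functional `T`
  set T : (ℂ → ℂ) → ℂ := fun ψ => (∫ z, ψ z ∂μ) -
    K * ∫ x in Ioo (p.re - ρ / 2) (p.re + ρ / 2),
      ψ ((x : ℂ) + (p.im : ℂ) * I) * gs ((x : ℂ) + (p.im : ℂ) * I) with hT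
  -- (i) additivity
  have hadd : ∀ φ ψ : ℂ → ℂ, ContDiff ℝ ∞ φ → HasCompactSupport φ → tsupport φ ⊆ ball p (ρ / 2) →
      ContDiff ℝ ∞ ψ → HasCompactSupport ψ → tsupport ψ ⊆ ball p (ρ / 2) →
        T (fun x => φ x + ψ x) = T φ + T ψ := by
    intro φ ψ hφ hφc hφs hψ hψc hψs
    simp only [hT]
    rw [integral_add (integrable_of_eq_zero_off_ball hfin hφ.continuous hφc (hoff φ hφs))
      (integrable_of_eq_zero_off_ball hfin hψ.continuous hψc (hoff ψ hψs))]
    simp_rw [add_mul]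
    rw [integral_add (hGint φ hφ.continuous) (hGint ψ hψ.continuous)]
    ring
  -- (ii) local vanishing
  have hloc : ∀ y ∈ ball p (ρ / 2), ∃ U : Set ℂ, IsOpen U ∧ y ∈ U ∧ ∀ ψ : ℂ → ℂ, ContDiff ℝ ∞ ψ →
      HasCompactSupport ψ → tsupport ψ ⊆ U → T ψ = 0 := by
    intro y hy
    by_cases hyim : y.im = p.im
    · ------------------------------------------------ gate points: Green
      obtain ⟨s, hs, hid⟩ := hgate y (ball_subset_ball hρ2.le hy) hyim
      refine ⟨ball y s ∩ ball p (ρ / 2), isOpen_ball.inter isOpen_ball, ⟨mem_ball_self hs, hy⟩, ?_⟩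
      intro ψ hψ hψc hψU
      have hψs : tsupport ψ ⊆ ball y s := hψU.trans inter_subset_left
      have hψV : tsupport ψ ⊆ ball p (ρ / 2) := hψU.trans inter_subset_right
      have hψρ : tsupport ψ ⊆ ball p ρ := hψV.trans (ball_subset_ball hρ2.le)
      have h1 := hid ψ hψ hψc hψs
      rw [setIntegral_carrier_eq_halfPlane D hflat hg hψρ] at h1
      have hgsd' : DifferentiableOn ℂ gs ({z : ℂ | p.im < z.im} ∩ ball p ρ) := by
        rw [← hflat]; exact hgsd
      have h2 := GateTrace.gateTrace_green_halfPlane gs ψ p.im (ball p ρ) isOpen_ball hgsd' hgsc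
        (hψ.of_le (by exact_mod_cast le_top)) hψc hψρ
      rw [h2, lineIntegral_eq_window p hψV gs] at h1
      -- `h1 : -(I/2) * ∫ ψ gs = θ * ∫ ψ dμ`
      have hX : ∫ z, ψ z ∂μ = K * ∫ x in Ioo (p.re - ρ / 2) (p.re + ρ / 2),
          ψ ((x : ℂ) + (p.im : ℂ) * I) * gs ((x : ℂ) + (p.im : ℂ) * I) := by
        calc ∫ z, ψ z ∂μ = θ⁻¹ * (θ * ∫ z, ψ z ∂μ) := by
              rw [← mul_assoc, inv_mul_cancel₀ hθ, one_mul]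
          _ = θ⁻¹ * (-(I / 2) * ∫ x in Ioo (p.re - ρ / 2) (p.re + ρ / 2),
                ψ ((x : ℂ) + (p.im : ℂ) * I) * gs ((x : ℂ) + (p.im : ℂ) * I)) := by rw [h1]
          _ = K * ∫ x in Ioo (p.re - ρ / 2) (p.re + ρ / 2),
                ψ ((x : ℂ) + (p.im : ℂ) * I) * gs ((x : ℂ) + (p.im : ℂ) * I) := by
              rw [hK]; ring
      simp only [hT]
      rw [hX, sub_self]
    · ------------------------------------------------ off the line: both sides vanish
      have hgap : 0 < |y.im - p.im| := abs_pos.2 (sub_ne_zero.2 hyim)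
      have hroom : 0 < ρ / 2 - dist y p := by linarith [mem_ball.1 hy]
      set s : ℝ := min (ρ / 2 - dist y p) |y.im - p.im| with hsdef
      have hs : 0 < s := lt_min hroom hgap
      refine ⟨ball y s, isOpen_ball, mem_ball_self hs, ?_⟩
      intro ψ hψ hψc hψU
      have hsub : ball y s ⊆ ball p (ρ / 2) := fun z hz => by
        rw [mem_ball] at hz ⊢
        have := min_le_left (ρ / 2 - dist y p) |y.im - p.im|
        linarith [dist_triangle z y p]
      have hψV : tsupport ψ ⊆ ball p (ρ / 2) := hψU.trans hsub
      have hoffl : ∀ z ∈ ball y s, z.im ≠ p.im := by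
        intro z hz hzim
        have h1 : |y.im - p.im| ≤ dist z y := by
          rw [← hzim]
          calc |y.im - z.im| = |(y - z).im| := by simp
            _ ≤ ‖y - z‖ := Complex.abs_im_le_norm _
            _ = dist z y := by rw [dist_comm, dist_eq_norm]
        have h2 : dist z y < s := mem_ball.1 hz
        linarith [min_le_right (ρ / 2 - dist y p) |y.im - p.im|]
      -- `∫ ψ dμ = 0`
      have hIψ : Integrable ψ μ := integrable_of_eq_zero_off_ball hfin hψ.continuous hψc (hoff ψ hψV)
      have hre_ts : tsupport (fun z => (ψ z).re) ⊆ tsupport ψ :=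
        closure_mono (Function.support_comp_subset (g := Complex.re) Complex.zero_re ψ)
      have him_ts : tsupport (fun z => (ψ z).im) ⊆ tsupport ψ :=
        closure_mono (Function.support_comp_subset (g := Complex.im) Complex.zero_im ψ)
      have hre : ∫ z, (ψ z).re ∂μ = 0 :=
        hvan _ (Complex.continuous_re.comp hψ.continuous) (hψc.comp_left Complex.zero_re)
          (hre_ts.trans hψV) fun z hz => hoffl z (hψU (hre_ts hz))
      have him : ∫ z, (ψ z).im ∂μ = 0 :=
        hvan _ (Complex.continuous_im.comp hψ.continuous) (hψc.comp_left Complex.zero_im)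
          (him_ts.trans hψV) fun z hz => hoffl z (hψU (him_ts hz))
      have hI0 : ∫ z, ψ z ∂μ = 0 := by
        apply Complex.ext
        · have h := integral_re hIψ
          simp only [RCLike.re_to_complex] at h
          rw [← h, hre, Complex.zero_re]
        · have h := integral_im hIψ
          simp only [RCLike.im_to_complex] at h
          rw [← h, him, Complex.zero_im]
      -- the line integrand vanishes
      have hpt : EqOn (fun x : ℝ => ψ ((x : ℂ) + (p.im : ℂ) * I) * gs ((x : ℂ) + (p.im : ℂ) * I))
          (fun _ => 0) (Ioo (p.re - ρ / 2) (p.re + ρ / 2)) := by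
        intro x _
        have hnot : (x : ℂ) + (p.im : ℂ) * I ∉ tsupport ψ := fun h =>
          hoffl _ (hψU h) (by simp)
        simp only
        rw [image_eq_zero_of_notMem_tsupport hnot, zero_mul]
      simp only [hT]
      rw [hI0, setIntegral_congr_fun measurableSet_Ioo hpt, integral_zero, mul_zero, sub_zero]
  ---------------------------------------------------------------- (iii) smooth test functions
  have hsmooth : ∀ ψ : ℂ → ℂ, ContDiff ℝ ∞ ψ → HasCompactSupport ψ → tsupport ψ ⊆ ball p (ρ / 2) →
      ∫ z, ψ z ∂μ = K * ∫ x in Ioo (p.re - ρ / 2) (p.re + ρ / 2),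
        ψ ((x : ℂ) + (p.im : ℂ) * I) * gs ((x : ℂ) + (p.im : ℂ) * I) := by
    intro ψ hψ hψc hψs
    have h := apply_eq_zero_of_locally_zero T hadd hloc hψ hψc hψs
    simp only [hT] at h
    exact sub_eq_zero.1 h
  ---------------------------------------------------------------- (iv) continuous test functions
  obtain ⟨M₀, hM₀⟩ := isCompact_Icc.exists_bound_of_continuousOn hgl
  set M : ℝ := max M₀ 0 with hMdef
  have hM : ∀ x ∈ Icc (p.re - ρ / 2) (p.re + ρ / 2), ‖gs ((x : ℂ) + (p.im : ℂ) * I)‖ ≤ M :=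
    fun x hx => (hM₀ x hx).trans (le_max_left _ _)
  have hIφ : Integrable φ μ := integrable_of_eq_zero_off_ball hfin hφ hφc (hoff φ hφs)
  rw [← sub_eq_zero, ← norm_eq_zero]
  refine le_antisymm (le_of_forall_pos_le_add fun ε hε => ?_) (norm_nonneg _)
  rw [zero_add]
  set A : ℝ := μ.real (closedBall p (ρ / 2)) + ‖K‖ * (M * (2 * (ρ / 2))) with hA
  have hA0 : 0 ≤ A := by positivity
  set η : ℝ := ε / (A + 1) with hη
  have hηpos : 0 < η := by positivity
  have hηA : η * A ≤ ε := by
    rw [hη, div_mul_eq_mul_div, div_le_iff₀ (by positivity)]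
    nlinarith
  obtain ⟨ψ, hψ, hψc, hψs, hclose⟩ :=
    exists_contDiff_dist_le_of_tsupport_subset isOpen_ball hφ hφc hφs hηpos
  have hIψ : Integrable ψ μ := integrable_of_eq_zero_off_ball hfin hψ.continuous hψc (hoff ψ hψs)
  have h1 := hsmooth ψ hψ hψc hψs
  -- the two error terms
  have hd1 : ‖(∫ z, φ z ∂μ) - ∫ z, ψ z ∂μ‖ ≤ η * μ.real (closedBall p (ρ / 2)) := by
    rw [← integral_sub hIφ hIψ]
    refine norm_integral_le_of_eq_zero_off_ball hfin (φ := fun z => φ z - ψ z) (fun z hz => ?_)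
      fun x => ?_
    · simp only [hoff φ hφs z hz, hoff ψ hψs z hz, sub_zero]
    · rw [norm_sub_rev]; exact hclose x
  have hd2 : ‖(∫ x in Ioo (p.re - ρ / 2) (p.re + ρ / 2),
        φ ((x : ℂ) + (p.im : ℂ) * I) * gs ((x : ℂ) + (p.im : ℂ) * I)) -
      ∫ x in Ioo (p.re - ρ / 2) (p.re + ρ / 2),
        ψ ((x : ℂ) + (p.im : ℂ) * I) * gs ((x : ℂ) + (p.im : ℂ) * I)‖ ≤ η * M * (2 * (ρ / 2)) := by
    refine norm_gateIntegral_sub_le (by positivity) (hGint ψ hψ.continuous) (hGint φ hφ) ?_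
    intro x hx
    rw [← sub_mul, norm_mul]
    have hx' : x ∈ Icc (p.re - ρ / 2) (p.re + ρ / 2) := Ioo_subset_Icc_self hx
    have hc : ‖φ ((x : ℂ) + (p.im : ℂ) * I) - ψ ((x : ℂ) + (p.im : ℂ) * I)‖ ≤ η := by
      rw [norm_sub_rev]; exact hclose _
    exact mul_le_mul hc (hM x hx') (norm_nonneg _) hηpos.le
  -- conclusion
  have hsplit : (∫ z, φ z ∂μ) - K * ∫ x in Ioo (p.re - ρ / 2) (p.re + ρ / 2),
        φ ((x : ℂ) + (p.im : ℂ) * I) * gs ((x : ℂ) + (p.im : ℂ) * I) =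
      ((∫ z, φ z ∂μ) - ∫ z, ψ z ∂μ) -
        K * ((∫ x in Ioo (p.re - ρ / 2) (p.re + ρ / 2),
            φ ((x : ℂ) + (p.im : ℂ) * I) * gs ((x : ℂ) + (p.im : ℂ) * I)) -
          ∫ x in Ioo (p.re - ρ / 2) (p.re + ρ / 2),
            ψ ((x : ℂ) + (p.im : ℂ) * I) * gs ((x : ℂ) + (p.im : ℂ) * I)) := by
    rw [h1]; ring
  rw [hsplit]
  calc ‖((∫ z, φ z ∂μ) - ∫ z, ψ z ∂μ) -
        K * ((∫ x in Ioo (p.re - ρ / 2) (p.re + ρ / 2),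
            φ ((x : ℂ) + (p.im : ℂ) * I) * gs ((x : ℂ) + (p.im : ℂ) * I)) -
          ∫ x in Ioo (p.re - ρ / 2) (p.re + ρ / 2),
            ψ ((x : ℂ) + (p.im : ℂ) * I) * gs ((x : ℂ) + (p.im : ℂ) * I))‖
      ≤ ‖(∫ z, φ z ∂μ) - ∫ z, ψ z ∂μ‖ +
          ‖K * ((∫ x in Ioo (p.re - ρ / 2) (p.re + ρ / 2),
            φ ((x : ℂ) + (p.im : ℂ) * I) * gs ((x : ℂ) + (p.im : ℂ) * I)) -
          ∫ x in Ioo (p.re - ρ / 2) (p.re + ρ / 2),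
            ψ ((x : ℂ) + (p.im : ℂ) * I) * gs ((x : ℂ) + (p.im : ℂ) * I))‖ := norm_sub_le _ _
    _ ≤ η * μ.real (closedBall p (ρ / 2)) + ‖K‖ * (η * M * (2 * (ρ / 2))) := by
        rw [norm_mul]
        exact add_le_add hd1 (mul_le_mul_of_nonneg_left hd2 (norm_nonneg _))
    _ = η * A := by rw [hA]; ring
    _ ≤ ε := hηA

/-! ### Registered form (sub-goal of `gateProfile_of_identification`) -/

/-- **Registered sub-goal `gateProfile_densityIdentification`** (crux item stmt-CriticalPhenomena-14004,
line `polygon-parity-squeeze`, stub `gateProfile_of_identification`, piece F of the (A) assembly):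
registry form (one `∀`-term) of `integral_eq_const_mul_lineIntegral` — the side measure on the gate
ball is a constant multiple of the candidate line density.
[cite: DuminilCopinSmirnov2012, §3 (the boundary part α of the strip)] -/
theorem gateProfile_densityIdentification : ∀ (D : DobrushinDomain) (ρ : ℝ), 0 < ρ → D.carrier ∩ Metric.ball (D.pt 1) ρ = {z : ℂ | (D.pt 1).im < z.im} ∩ Metric.ball (D.pt 1) ρ → ∀ (g gs : ℂ → ℂ), Set.EqOn g gs (D.carrier ∩ Metric.ball (D.pt 1) ρ) → DifferentiableOn ℂ gs (D.carrier ∩ Metric.ball (D.pt 1) ρ) → ContinuousOn gs ({z : ℂ | (D.pt 1).im ≤ z.im} ∩ Metric.ball (D.pt 1) ρ) → ∀ (μ : MeasureTheory.Measure ℂ), μ (Metric.closedBall (D.pt 1) (ρ / 2)) < ⊤ → (∀ w : ℂ → ℝ, Continuous w → HasCompactSupport w → tsupport w ⊆ Metric.ball (D.pt 1) (ρ / 2) → (∀ z ∈ tsupport w, z.im ≠ (D.pt 1).im) → ∫ z, w z ∂μ = 0) → ∀ (θ : ℂ), θ ≠ 0 → (∀ y ∈ Metric.ball (D.pt 1)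 ρ, y.im = (D.pt 1).im → ∃ s : ℝ, 0 < s ∧ ∀ φ : ℂ → ℂ, ContDiff ℝ ∞ φ → HasCompactSupport φ → tsupport φ ⊆ Metric.ball y s → ∫ w in D.carrier, g w * Literature.Analysis.Complex.dbarAlong 1 φ w = θ * ∫ w, φ w ∂μ) → ∀ (φ : ℂ → ℂ), Continuous φ → HasCompactSupport φ → tsupport φ ⊆ Metric.ball (D.pt 1) (ρ / 2) → ∫ z, φ z ∂μ = (-(Complex.I / 2) / θ) * ∫ x in Set.Ioo ((D.pt 1).re - ρ / 2) ((D.pt 1).re + ρ / 2), φ ((x : ℂ) + ((D.pt 1).im : ℂ) * Complex.I) * gs ((x : ℂ) + ((D.pt 1).im : ℂ) * Complex.I) :=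
  fun D _ hρ hflat _ _ hg hgsd hgsc _ hfin hvan _ hθ hgate _ hφ hφc hφs =>
    integral_eq_const_mul_lineIntegral D hρ hflat hg hgsd hgsc hfin hvan hθ hgate hφ hφc hφs

end Summit.CriticalPhenomena.SAWScalingLimit.Theorems.PolygonParitySqueeze.GateProfile

end
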